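import Summits.QuantumFields.QCD.Theses.HeatSlicedQuarks
import Summits.QuantumFields.QCD.Theses.GradientFlowSpecies
import Summits.QuantumFields.QCD.Theorems.GluonicCompletion.Negative.Threshold
import Summits.QuantumFields.QCD.Theorems.RobustYangMillsHandover.Negative.GapClauses
import Summits.QuantumFields.QCD.Theorems.RobustYangMillsHandover.Negative.WithoutNontriviality
import Summits.QuantumFields.QCD.Theorems.RobustYangMillsHandover.Negative.SchemeAsymptotics
import Summits.QuantumFields.QCD.Theorems.RobustYangMillsHandover.Negative.FreeWilsonModes
import Summits.QuantumFields.QCD.Theorems.RobustYangMillsHandover.Negative.HoppingWindow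
import Literature.MathematicalPhysics.QuantumFieldTheory.BlockScaleEffectivePerturbation

/-!
# Line `two-scale-lsi-handover` — checked skeleton for the crux
`Summit.QuantumFields.QCD.Theses.HeatSlicedQuarks.RobustYangMillsHandover` (stmt-QuantumFields-8892)

Planner crux-plan, round 1 (skeleton gen 1; gen-2 refresh 2026-08-16: re-verified against the standing disproof
rev 7 = cycle 3, imports the fifth landed Negative module `HoppingWindow` (p76404) and USES its §12(A) lemma in the
sorry-free `fineHopping_lt_sixth_of_honest` below; stub names and signatures UNCHANGED). Idea card
`Cruxes/RobustYangMillsHandover/Ideas/two-scale-lsi-handover.md`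
(ideator 3: "ask Yang–Mills for block-scale functional-inequality DATA at ONE hadronic block scale, not for an
open gapped phase — robustness becomes Holley–Stroock plus a triangle inequality"), triage `TRIAGE-r1-{1,2,3}.md`
(3 × pass; mandatory sharpenings honoured below), standing disproof `Cruxes/RobustYangMillsHandover/Disproof.lean`
(cycles 1–3, §§1–12; landed `Theorems/RobustYangMillsHandover/Negative/{WithoutNontriviality,GapClauses,
SchemeAsymptotics,FreeWilsonModes,HoppingWindow}.lean` — all five imported here, so every stub below is elaborated
against them), obstruction notes `FINDINGS-g2k1.md` (B2: β-universality is necessary; B4: a hadronic handover scale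
presupposes a Yang–Mills-side transport), head line `Lines/existence-pays-the-continuum-half.lean` (common head of
every mechanism line: `GapTransfer (8923) → MassiveLatticeGap (8922) → crux`). Line card: `Lines/two-scale-lsi-handover.md`.

## The line in one paragraph

The crux is the bare arrow `ContinuumQCDExists → QCD`. As every triager recommends, the line PLUGS INTO THE COMMON
HEAD: it keeps X₀'s own honest regularisation, reads the continuum gap clause off the lattice one by
`stub_gapTransfer` (= item 8923 BY NAME), and proves the lattice half — literally item
`GradientFlowSpecies.MassiveLatticeGap` (8922), theorem `massiveLatticeGap_of_stubs` below — from FIVE mechanism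
stubs. The mechanism (card, with the triage sharpenings): block the lattice-QCD gauge field to ONE hadronic block
scale `ℓ₁` by an (uneven) axial blocking; above the free mass threshold the blocked SIGNED QCD weight is a positive
multiple of `e^{-W'} ×` (blocked Wilson Yang–Mills weight at the MATCHED asymptotically free coupling `β'`), `W'` a
quasi-local block-scale perturbation that is small in the Kotecký–Preiss norm with range control
(`stub_heavyQuarkBlockRemainder`: heavy-quark block integration + fibre-averaged positivity — cards
proper-time-residual-determinant / rao-blackwell-sign folded in); the Yang–Mills INPUT is TWO-SCALE DATA IN
DOBRUSHIN–ZEGARLINSKI (oscillation) FORM for the blocked pure-gauge measure at scale `ℓ₁` along EVERY a.f. sequence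
(`stub_twoScaleYM`, the named condition of this conditional-flavour crux: blocked measure = Gibbs measure
`e^{-βₑA(V) - D(V) - O(V)}` with `|βₑ|` small, `D` cube-diagonal and merely BOUNDED — "diagonal blocks are paid by
oscillation" — and `O` KP-small with range control — "only inter-block couplings must be small"); the OPENNESS of
such data is a THEOREM (`stub_twoScaleCriterion`: block Dobrushin–Zegarlinski + Holley–Stroock per cube +
Efron–Stein, for any compact group: data with margin ⇒ uniform heat-bath Poincaré inequality), and the quark
remainder `W'` enters it through ONE TRIANGLE INEQUALITY for the KP norm, which is performed INSIDE THE SORRY-FREE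
COMPOSITION (`QuasiLocalGaugePerturbation.NormLE.add`, see `massiveLatticeGap_of_stubs`); a uniform Poincaré
inequality plus quasi-locality gives exponential clustering of block observables at a rate `m` per block
(`stub_perturbedPoincareToClustering`, the quasi-local twin of item 9444 WITH the (h4) range control the triage
demanded), i.e. physical rate `≥ m/(4ℓ₁)` uniformly in `k` and in the volume; finally block clustering plus the
block representation give the full-spectrum lattice gap clause for ALL fine lattice-QCD observables above the
threshold (`stub_fineFromBlock`: gluonic channels by the fixed-cutoff transfer matrix, flavoured channels by heavy
quark lines). Six registered stubs, composition `RobustYangMillsHandover_of` (sorry-free outside the stubs).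

Currency decision (card: "the crux-plan stage should pick ONE form"; triage 2/3: "pick one form"): the HEAT-BATH
(one-link conditional law) form of the Poincaré inequality — the form of items 9441/9444/9446 of route
`FradkinShenkerFlow` — and the DOBRUSHIN–ZEGARLINSKI oscillation form of the two-scale data (the card's allowed
"Stroock–Zegarlinski uniform-in-boundary-condition form"; `Zegarlinski1992`, `StroockZegarlinski1992Equivalence`),
NOT the gradient / Otto–Reznikoff mixed-Hessian form: the tree's D1 activities (`QuasiLocalGaugePerturbation.act`) are
bounded measurable functions of the links with no differentiability, so Hessians of `W.total` are not typable over
existing declarations, while oscillations and KP norms (`NormLE`) are; the Otto–Reznikoff criterion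
(`OttoReznikoff2007` Thm. 1) remains the LSI-currency sibling of `stub_twoScaleCriterion` and is cited there.

New object (definition request filed with the ledger): `unevenAxialLink b N T` (§0) — the axial block averaging
from a fine torus of ARBITRARY side `N` to a block torus of side `T` with nominal block factor `b`, the last cube in
each direction absorbing the remainder (`HasLatticeMassGap` quantifies over ALL odd torus sides, while the tree's
`GaugeBlockAveraging` fixes the fine side to `b · S`). It is a concrete `def` over the tree's `transport`, not an
axiom; `measurable_unevenAxialLink` is proved.

## Disproof.lean, honoured (cited by section; no literal `_false_without_` theorem exists for this crux)

* §2 `handoverWithoutNontriviality_iff_qcd` (landed `Negative.WithoutNontriviality`) — THE load-bearing obstruction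
  ("a proof must USE the non-triviality of the handed-over `T`"): the line uses H at `stub_heavyQuarkBlockRemainder`
  AND at `stub_fineFromBlock`, whose hypothesis is the full honest `∃ reg`-body of X₀ INCLUDING the three
  non-triviality clauses — only for an honest `reg` does "all `m_f` above a threshold" mean physically heavy quarks
  (the junk `canonicalAF`/vacuum witness of `continuumQCDExists_withoutNontriviality_holds` has cutoff-decoupled
  quarks and is outside the hypothesis class).
* §1 `not_handover_iff`, `handover_iff_target_iff_qcd`: X₀'s truth value is never touched; same-regularisation proof.
* §3 `vacuum_not_witness`: no stub uses vacuum / `canonicalAF` / `z = 0` data as a witness.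
* §5/§8 `handover_of_aboveThreshold`, `continuumQCDExists_iff_threshold`: thresholds everywhere are AFTER `reg`
  (`∃ M₅`, `∃ M₆`), absorbed by the landed `qcdOf_iff_threshold` in the head composition.
* §6 `sameReg_iff`, `hasLatticeMassGap_scheme_indep`, `hasLatticeMassGap_anti` (landed `Negative.GapClauses`,
  imported and USED in `handover_of_gapTransfer_of_massiveLatticeGap`): the lattice half proved here is §6's
  `SameRegLatticeGap` above a threshold, i.e. item 8922.
* §9(i) `quarkLoopShift_tendsto_atTop` (landed `Negative.SchemeAsymptotics`): honoured EXPLICITLY — the blocked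
  Yang–Mills reference in `stub_heavyQuarkBlockRemainder` sits at a MATCHED coupling sequence `β'` (a.f. with the
  `N_f = 0` profile at some `Λ' ≥ Λs`), never at `β_k`; the divergent marginal shift lives in `β' - β`, only the
  KP-small remainder `W'` is perturbative; and `stub_twoScaleYM` is asked along EVERY a.f. sequence (β-universality,
  FINDINGS B2: necessary for every handover line).
* §9(ii)/§10 `scheme_mq_eventually_neg`, `accretivity_tight` (landed `SchemeAsymptotics`, `FreeWilsonModes`): no
  fine-operator coercivity is claimed anywhere; the quark remainder and the quark lines are BLOCK-scale objects
  (stubs 5 and 6 say so in their docstrings).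
* §11 (Heller's fundamental–adjoint critical endpoint, barrier candidate `MixedActionCriticalEndpoint`): the YM data
  are asked only along the Wilson axis at block scales `≥ Cℓ/Λ'`, and the openness radius `εs` of
  `stub_twoScaleCriterion` is a small KP ball at that block scale — it does not claim openness up to any bulk
  critical surface.
* §12 (cycle 3; landed `Negative.HoppingWindow`, p76404 — imported): (A) the fine hopping parameter of the
  handed-over trajectory lies eventually in `1/8 < κ_f(k) < 1/6` — the UPPER edge is USED by the line
  (`fineHopping_lt_sixth_of_honest` below: for an honest `reg` the scheme `reg.scheme m 0 0` of stubs 5–6 is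
  eventually in Lüscher's range `κ < 1/6`, where the Wilson-fermion transfer matrix `𝕋_k` of `stub_fineFromBlock`
  (G) is positive), the LOWER edge `κ > 1/8` (with (B): the heavy-mass Neumann bound is attained at `U ≡ 1`, the
  hopping series diverges on constant modes for `m ≤ 0`) is WHY no stub hopping-expands or inverts the FINE
  Wilson–Dirac operator at the scheme's bare mass — the quark remainder (`stub_heavyQuarkBlockRemainder`) and the
  quark lines (`stub_fineFromBlock` (Q)) are BLOCK-scale objects above the threshold; (C) the sign barriers
  `WilsonDeterminantSign` / `WilsonDeterminantMassSplitting` transfer verbatim to the massive conjunct's SIGNED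
  functional `qcdTorusExpect` (`splitWeight_neg_imp_zeroMode_between`): honoured by construction — no stub treats
  the fine signed weight as a probability measure; positivity is demanded only of the FIBRE-AVERAGED weight
  (`stub_heavyQuarkBlockRemainder`: `Z ≠ 0` real times `e^{−W'}`, a.e. in the block field, for BOTH conjuncts — the
  "Rao–Blackwell step" §12 says every positivity-based lever needs), block observables are then expectations of a
  genuine probability measure (`(D + O + W').perturbedMeasure`, the `Z` cancels in the ratio), and fine observables
  are reached through the transfer matrix, whose positivity (Lüscher, `κ < 1/6`) is configuration-sign-blind.
* `-- Targets`: none at plan time (Disproof rev 7: "no line picked yet"). Negatives index (9665, 9603, 9494, 9599):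
  none is an instance or weakening of a stub; the 9599 lesson (a dropped normalisation constant kills a typed
  clause) is respected — every identity below carries its explicit constant `Z` and uses NORMALISED measures
  (`perturbedMeasure`).
-/

noncomputable section

namespace Summit.QuantumFields.QCD.Cruxes.RobustYangMillsHandover.TwoScaleLsiHandover

open Summit.QuantumFields.QCD.Theses.HeatSlicedQuarks (ContinuumQCDExists RobustYangMillsHandover)
open Summit.QuantumFields.QCD.Theorems.GluonicCompletion.Negative (qcdOf_iff_threshold)
open Literature.MathematicalPhysics.QuantumFieldTheory Literature.MathematicalPhysics.QuantumLattice
open Literature.MathematicalPhysics.AQFT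
open MeasureTheory Filter Topology

/-! ## §0 The uneven axial blocking (new object; definition request `UnevenAxialBlocking`) -/

section Blocking

variable {G : Type*}

/-- Fine-lattice representative (base corner) of the block site `y` of the block torus of side `T`, for nominal
block factor `b`, inside the fine torus of side `N`: coordinatewise `b · y_i` on representatives `y_i ∈ {0,…,T-1}`.
[folklore] -/
def unevenCorner (b N T : ℕ) (y : Site 4 T) : Site 4 N :=
  fun i => ((b * (y i).val : ℕ) : ZMod N)

/-- Length (in fine lattice units) of the straight block-link path from the corner of `y` in direction `μ`: `b`,
except for the LAST block in that direction (`y_μ = T - 1`), whose path has length `N - b (T - 1)` and so absorbs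
the remainder of `N` modulo `b` (for `b T ≤ N < b (T + 2)` every length lies in `[b, 3b)`). [folklore] -/
def unevenLen (b N T : ℕ) (y : Site 4 T) (μ : Fin 4) : ℕ :=
  if (y μ).val + 1 = T then N - b * (T - 1) else b

/-- **Uneven axial block averaging of the gauge field**: the block link `(y, μ)` of the block torus of side `T`
carries the straight-line parallel transporter (tree `transport`) of the fine field from the corner of `y`, of
length `unevenLen b N T y μ` in direction `μ` — Bałaban's axial block link variable (CMP 95 (1984) (1.4)–(1.6); the
tree's `GaugeBlockAveraging.axial`) generalised to fine tori whose side `N` is NOT a multiple of the block factor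
(the lattice-gap clause of `QCDOf` ranges over all odd torus sides). Gauge covariant with respect to
`g ↦ g ∘ unevenCorner`; consecutive paths in one direction tile the fine cycle exactly when `b (T-1) ≤ N`.
[cite: Balaban1984Propagators, §1 (1.4)–(1.7)] -/
def unevenAxialLink [Monoid G] (b N T : ℕ) (U : GaugeConfig 4 N G) : GaugeConfig 4 T G :=
  fun e => transport U (unevenCorner b N T e.1) (List.replicate (unevenLen b N T e.1 e.2) e.2)

/-- The uneven axial blocking is measurable (each block link is an ordered product of coordinate projections).
[folklore] -/
theorem measurable_unevenAxialLink [Group G] [MeasurableSpace G] [MeasurableMul₂ G] (b N T : ℕ) :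
    Measurable (unevenAxialLink (G := G) b N T) :=
  measurable_pi_lambda _ fun _ => measurable_transport _ _

end Blocking

/-- The `SU(3)` fundamental lattice representation as `LatticeRep` data (the instance at which the two
group-general stubs are used by the composition). [folklore] -/
def su3Rep : LatticeRep (Matrix.specialUnitaryGroup (Fin 3) ℂ) :=
  ⟨3, fundamentalRep (Fin 3), continuous_fundamentalRep _, fundamentalRep_injective _,
    fundamentalRep_mem_unitaryGroup⟩

/-! ## §1 The six registered stubs (the only `sorry`s of the line) -/

/-- **stub_gapTransfer — the continuum-half ENGINE** = item `GradientFlowSpecies.GapTransfer`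
(stmt-QuantumFields-8923) BY NAME, shared with the head line `existence-pays-the-continuum-half` (same stub, same
three honest gaps G1–G3 recorded there: `(−1)^F`-twisted torus trace vs vacuum at fixed `k`; `S → ∞` before
`k → ∞`; norm constants through the fixed-`k` transfer-matrix Hilbert space):
`∀ Nf sch T Δ Δ', 0 < Δ' → Δ' < Δ → IsQCDAlong sch T → sch.HasLatticeMassGap Δ → T.HasMassGap Δ'`.
USED by the head composition at `sch := reg.scheme m z shift`, `Δ' := Δ/2`. Size M–L. Closes when 8923 closes.
[cite: Luscher1977] [cite: OsterwalderSeiler1978, §§2–4] -/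
theorem stub_gapTransfer : Summit.QuantumFields.QCD.Theses.GradientFlowSpecies.GapTransfer := by
  sorry

/-- **stub_twoScaleCriterion — OPENNESS IS A THEOREM (block Dobrushin–Zegarlinski + Holley–Stroock per cube +
Efron–Stein; heat-bath Poincaré currency; any compact group).** For every compact group `G` with lattice
representation `r`, cube size `c ≥ 1` (in block-lattice units), diagonal budget `K₁` (and its KP shadow `K₂`) and KP
rate `κ > 0` there are a SMALLNESS `εs > 0` and a constant `CP` such that: for every coupling `|β| ≤ εs`, every
block torus `2S+1`, every CUBE-DIAGONAL perturbation `D` (activities only on single `c`-cubes, `|D_X| ≤ K₁` —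
arbitrary bounded self-interaction of each cube: NO smallness, NO convexity) and every quasi-local `O` with
`‖O‖_{c,κ} ≤ εs`, the Gibbs measure `μ = (D + O).perturbedMeasure r.ρ β ∝ e^{-βA(V) - D(V) - O(V)} ∏ dV` satisfies the
uniform HEAT-BATH POINCARÉ INEQUALITY `Var_μ(F) ≤ CP Σ_ℓ ∫∫ (F(V) − F(V[ℓ ↦ g]))² dν_ℓ^V(g) dμ(V)` for all bounded
measurable `F`, `ν_ℓ^V` the one-link conditional law of `μ` (Haar tilted by `−βA − (D+O).total` in the link `ℓ`).
Proof route: (1) the part of the Hamiltonian seen by the links of one cube `Q` has oscillation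
`≤ 2K₁ + (1 + C(c, r.N)) εs` (D through its own singleton activity only — THIS is where "diagonal blocks are paid by
oscillation" enters; `O` through `Σ_{X ∋ Q} ‖O_X‖ ≤ ‖O‖_{c,κ}`; Wilson plaquettes touching `Q` through `2 r.N |β|`
each), so by Efron–Stein for the product Haar measure on `Q`'s links and Holley–Stroock (twice) the conditional law
on `Q` given the outside satisfies the heat-bath Poincaré inequality with `C₁ = e^{4 K_Q}` UNIFORMLY in the boundary
condition; (2) the Dobrushin interdependence (total-variation) coefficients between cubes are bounded by the
oscillation in cube `Q'` of the terms touching cube `Q`: `D` contributes NOTHING (cube-diagonal), straddling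
plaquettes `≤ C(c, r.N) εs`, and `Σ_{Q'} Σ_{X ∋ Q, Q'} ‖O_X‖ ≤ ‖O‖_{c,κ}/(eκ)`; so for `εs` small (depending on
`K₁, κ, c, r.N`) the cube system satisfies Dobrushin's uniqueness condition with coefficient `≤ 1/2`; (3) Dobrushin
⇒ spectral gap `≥ 1/2` of the cube heat-bath dynamics (Wu 2006; Zegarlinski 1992 for the LSI version;
Dyer–Goldberg–Jerrum for finite spins), and composing with (1) by the tower property gives the single-link
heat-bath Poincaré inequality with `CP = C₁` (up to the factor `2 = ∫∫(F(V) − F(V^{ℓ←g}))² / Var_ℓ`).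
The LSI-currency sibling is Otto–Reznikoff's criterion (JFA 243 (2007) Thm. 1: `diag(ρ_i) − (κ_{ij}) ≥ ρ > 0` ⇒
LSI(ρ)) and its compact-spin ancestor Stroock–Zegarlinski; the heat-bath/oscillation form is chosen because D1
activities are only bounded measurable. Why it might fail: it should not — it is a theorem of the
Dobrushin–Zegarlinski–Wu type; the Lean cost is Wu's contraction argument for general compact spin spaces (the
tree has Dobrushin machinery for uniqueness/decay in `LatticeGaugeDobrushin`, `abs_integral_tilted_add_sub_le`, and
the `SU(N)` Haar Poincaré inequality `SUNBakryEmery.haarPoincare_SU`, none of which is needed in heat-bath form: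
Efron–Stein needs no curvature). Degenerate checks: `K₁ < 0` or `K₂ < 0` make the hypotheses unsatisfiable
(vacuous); `CP ≤ 0` never needed; finite or abelian `G` are covered (high-temperature statement, no confinement
physics inside). Size: L (M for finite `G`). Leans on: tree `QuasiLocalGaugePerturbation.{act, total, NormLE,
weightedSum, perturbedMeasure, dependsOn}`, `haarProbability`, `wilsonAction`, Mathlib `Measure.tilted`,
`ProbabilityTheory.variance`.
[cite: Wu2006] [cite: Zegarlinski1992] [cite: StroockZegarlinski1992Equivalence] [cite: HolleyStroock1987]
[cite: OttoReznikoff2007, Thm. 1] [cite: Dobrushin1968] [cite: Martinelli1999] -/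
theorem stub_twoScaleCriterion :
    ∀ (G : Type) [Group G] [TopologicalSpace G] [IsTopologicalGroup G] [CompactSpace G]
      [MeasurableSpace G] [BorelSpace G], ∀ (r : LatticeRep G) (c : ℕ) (K₁ K₂ κ : ℝ), 0 < c → 0 < κ →
      ∃ εs : ℝ, 0 < εs ∧ ∃ CP : ℝ, ∀ β : ℝ, |β| ≤ εs →
        ∀ (S : ℕ) (D O : QuasiLocalGaugePerturbation 4 (2 * S + 1) G c),
          (∀ X : Finset (Site 4 (2 * S + 1)), X.card ≠ 1 → ∀ V : GaugeConfig 4 (2 * S + 1) G, D.act X V = 0) →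
          (∀ (X : Finset (Site 4 (2 * S + 1))) (V : GaugeConfig 4 (2 * S + 1) G), |D.act X V| ≤ K₁) →
          D.NormLE κ K₂ → O.NormLE κ εs →
          ∀ F : GaugeConfig 4 (2 * S + 1) G → ℝ, Measurable F → (∃ M : ℝ, ∀ U, |F U| ≤ M) →
            ProbabilityTheory.variance F ((D + O).perturbedMeasure r.ρ β) ≤
              CP * ∑ ℓ : Edge 4 (2 * S + 1), ∫ U, ∫ g, (F U - F (Function.update U ℓ g)) ^ 2
                ∂((haarProbability G).tilted (fun g' =>
                    -(β * wilsonAction r.ρ (Function.update U ℓ g') + (D + O).total (Function.update U ℓ g'))))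
                ∂((D + O).perturbedMeasure r.ρ β) := by
  sorry

/-- **stub_perturbedPoincareToClustering — uniform heat-bath Poincaré + quasi-locality ⇒ exponential clustering
(the card's typed first lemma `PerturbedPoincareToClustering`, SHARPENED as all three triagers demanded: (h4) RANGE
CONTROL added, constants split — the rate `m` depends only on `(G, r, c, κ, η, CP, βmax)`, the prefactor `C` also on
the observables `A, B`; the quasi-local twin of item `FradkinShenkerFlow.PoincareToClustering`, stmt-9444).** For
every compact `G`, `r`, cube size `c ≥ 1`, KP data `(κ > 0, η)`, Poincaré constant `CP` and coupling bound `βmax`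
there is `m > 0` such that for all bounded gauge-invariant cylinder observables `A, B` of `ℤ⁴` there is `C` with:
for every `|β| ≤ βmax`, every block torus `2S+1` and every quasi-local `W` at cube scale `c` with `‖W‖_{c,κ} ≤ η`,
RANGE CONTROL (every activity-carrying polymer `X` has coordinate diameter `≤ c·|X|`, verbatim the clause (h4) of
`HeavyThresholdYMBridge.RobustYangMills` rev 4) and the heat-bath Poincaré inequality with constant `CP` for
`W.perturbedMeasure r.ρ β`, the connected Euclidean-time correlations obey
`|⟨A · τ_n B⟩ − ⟨A⟩⟨B⟩| ≤ C e^{−m n}` for all `n ≤ S`. Proof route (9444's, triage 2 re-derived it): spectral gap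
`λ ≥ 1/(2 CP)` of the continuous-time single-link heat-bath generator `Σ_ℓ (E_ℓ − 1)`;
`Cov(F, G) = ∫₀^∞ ℰ(P_t F, G) dt`; the jump rates are `≤ 1` and the new link value's law depends on other links only
through plaquettes (range 1, `|β| ≤ βmax`) and through polymers `X ∋` the link's cube, whose influence is summable
with exponential tails BECAUSE of `‖W‖_{c,κ} ≤ η` AND range control (an activity coupling lattice distance `n` needs
`|X| ≥ n/c` blocks, price `e^{κ n / c}`) — exponential light cone (Lieb–Robinson-type bookkeeping for a classical
jump process); split at `t* ∝ n`; observables whose support exceeds small tori are absorbed in `C`. The gradient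
(Langevin) model of the same argument is Shen–Zhu–Zhu §4.3 / Cor. 1.4 "Mass gap" (Poincaré ⇒ exponential decay via
`P_t(fg) − P_t f P_t g = 2Σ_e∫P_s⟨∇_e P_{t−s}f, ∇_e P_{t−s}g⟩ ds`, after Guionnet–Zegarlinski). Why it might fail:
without range control it is FALSE (triage 1's witness W-pair: a range-`S` two-cube activity of norm `≤ η` gives
`S`-independent correlations `ε/4`; with `c = 0` the class degenerates to global mean-field couplings with
`1/volume` correlations) — both excluded by `0 < c` and the (h4) clause; with them it is the standard "uniform
Glauber gap + finite speed ⇒ exponential clustering" (triage 1: plausible-true). Junk checks: `η < 0` or `CP ≤ 0`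
make the hypotheses unsatisfiable; `β < 0` is harmless. Size: L. Leans on: tree `QuasiLocalGaugePerturbation.
{NormLE, act, total, perturbedMeasure, connectedCorr}`, `polymers`, `YMSpecies`, `torusLift`, `configShift`,
item 9444 (the `W = 0` case). [cite: Martinelli1999] [cite: Liggett2005] [cite: ShenZhuZhu2023, §4.3 and Cor. 1.4]
[cite: Kunsch1982] [cite: Follmer1988] -/
theorem stub_perturbedPoincareToClustering :
    ∀ (G : Type) [Group G] [TopologicalSpace G] [IsTopologicalGroup G] [CompactSpace G]
      [MeasurableSpace G] [BorelSpace G], ∀ (r : LatticeRep G) (c : ℕ) (κ η CP βmax : ℝ), 0 < c → 0 < κ →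
      ∃ m : ℝ, 0 < m ∧ ∀ A B : YMSpecies G, ∃ C : ℝ, ∀ β : ℝ, |β| ≤ βmax →
        ∀ (S : ℕ) (W : QuasiLocalGaugePerturbation 4 (2 * S + 1) G c), W.NormLE κ η →
          (∀ X : Finset (Site 4 (2 * S + 1)), X ∈ polymers c →
            (∃ U : GaugeConfig 4 (2 * S + 1) G, W.act X U ≠ 0) →
            ∀ y ∈ X, ∀ y' ∈ X, ∀ i : Fin 4, (y i - y' i).val ≤ c * X.card ∨ (y' i - y i).val ≤ c * X.card) →
          (∀ F : GaugeConfig 4 (2 * S + 1) G → ℝ, Measurable F → (∃ M : ℝ, ∀ U, |F U| ≤ M) →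
            ProbabilityTheory.variance F (W.perturbedMeasure r.ρ β) ≤
              CP * ∑ ℓ : Edge 4 (2 * S + 1), ∫ U, ∫ g, (F U - F (Function.update U ℓ g)) ^ 2
                ∂((haarProbability G).tilted (fun g' =>
                    -(β * wilsonAction r.ρ (Function.update U ℓ g') + W.total (Function.update U ℓ g'))))
                ∂(W.perturbedMeasure r.ρ β)) →
          ∀ n : ℕ, n ≤ S → |W.connectedCorr r.ρ β A.F B.F n| ≤ C * Real.exp (-(m * n)) := by
  sorry

/-- **stub_twoScaleYM — THE YANG–MILLS-SIDE NAMED CONDITION (HARDEST stub; conditional input of this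
conditional-flavour crux): HADRONIC TWO-SCALE DATA IN DOBRUSHIN–KOTECKÝ–PREISS (oscillation) FORM for blocked
`SU(3)` Wilson lattice Yang–Mills along EVERY asymptotically free sequence.** There are a cube size `c ≥ 1`, budgets
`K₁, K₂` and a KP rate `κ > 0` such that for every target smallness `ε > 0` there is `Cℓ > 0` with: for every
lattice scale parameter `Λ' > 0`, every block scale `ℓ₁ ≥ Cℓ/Λ'` (physically: deep enough in the hadronic regime,
`ℓ₁ Λ' ≥ Cℓ(ε)`), every sequence of spacings `a_k → 0` and EVERY coupling sequence `β'` with `N_f = 0` two-loop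
asymptotic scaling at `Λ'` (`β'_k − afBeta 0 Λ' a_k → 0` — β-universality, FINDINGS B2: necessary for every handover
line), EVENTUALLY IN `k` and UNIFORMLY over ALL block tori: for every block torus side `2S''+1` and every fine torus
side `N` in the window `b_k (2S''+1) ≤ N < b_k (2S''+3)`, `b_k = ⌊ℓ₁/a_k⌋` (so that the uneven axial cubes have sides
in `[b_k, 3 b_k)`), the push-forward of the Wilson measure `μ_{N, β'_k}` under `unevenAxialLink b_k N (2S''+1)` IS
the Gibbs measure `(D + O).perturbedMeasure ρ βₑ ∝ exp(−βₑ A(V) − D(V) − O(V)) ∏ dV` on the block torus with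
`|βₑ| ≤ ε` (residual block plaquette coupling small), `D` CUBE-DIAGONAL with `|D_X| ≤ K₁` and `‖D‖_{c,κ} ≤ K₂`
(arbitrary bounded self-interaction of each `c`-cube of block links — NOT small: "diagonal blocks are paid by
oscillation", `K₁` fixed BEFORE `ε`), and `O` with `‖O‖_{c,κ} ≤ ε` AND range control (h4) ("only inter-block
couplings must be small", decaying like `e^{−κ·distance/c}` in block units = `e^{−(κ/(cℓ₁))·distance}` physically).
This is "hadronic disorder" of the renormalisation-group trajectory in a quantitative Dobrushin–KP form: after
blocking past the confinement scale the effective action of the block field is short-ranged and weak BETWEEN cubes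
(Wilson's strong-coupling picture of the IR fixed point; MCRG lore), uniformly in the volume. It is STRONGER than
`YMLatticeGapAlongAFSequences` (8796; it implies it via stubs 3–4 and a YM-only version of stub 6) and of
complete-analyticity strength at one hadronic scale (triage cross-note 2), DIFFERENT IN KIND from `RobustYangMills`
(13897): no admissibility cone, no OS/E1/non-Gaussianity clause, no openness postulated — openness is stub 3.
Why it might fail (the bet): (a) it contains the `SU(3)` weak-coupling lattice mass gap and its β-universality
(`PerturbativeInvisibility`: invisible to any expansion in `g`); (b) the representation is demanded POINTWISE over
ALL block fields with sup-norm (oscillation) control — a slow/rare block-field mode surviving at hadronic scales on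
symmetric tori (e.g. a topological block observable with `k`-growing autocorrelation) would falsify the uniform
Dobrushin smallness; known topological freezing is a CUTOFF-scale phenomenon living in the fibre, not in the block
marginal (card, cheapest falsifier (ii)); (c) `S'' = 0` is included: the law of the four Polyakov holonomies of a
symmetric fine torus of side `∈ [ℓ₁, 3ℓ₁)` must have `−log`-density bounded by `K₁` uniformly — consistent with
unbroken centre symmetry on SYMMETRIC tori (barriers `CenterSymmetryBreakingByQuarks`/`FiniteTemperatureDeconfinement`
concern asymmetric, thermal geometries). Refutable cheaply in part: `kit` numerics of the card's falsifier (i)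
(conditional covariance of adjacent BLOCK plaquettes given all other block links at `b a ≈ 0.5, 1 fm`, `SU(2)`
proxy) test the inter-cube smallness. Degenerate checks: `b_k = 0` (early `k`) empties the window; the identity pins
`(βₑ, D, O)` only through the total density, so the splitting freedom is the prover's; representability of the
blocked density in D1's class at each FIXED `(k, S'', N)` is automatic (positive continuous density on a compact
space; lump into one polymer) — the content is the UNIFORMITY of `(K₁, K₂, κ, ε)` in `k`, `S''`, `N`, `β'`.
Size: open-problem (a theory). Leans on: tree `wilsonMeasure`, `afBeta`, `fundamentalRep`,
`QuasiLocalGaugePerturbation.{act, NormLE, perturbedMeasure}`, `polymers`, Mathlib `Measure.map`; §0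
`unevenAxialLink`. Sources: Wilson's block-spin RG / strong-coupling fixed point; Bałaban's effective-action format;
Dobrushin–Shlosman complete analyticity; the β-universality item 8796 and FINDINGS B2/B4.
[cite: JaffeWitten2000, §5] [cite: Balaban1988Convergent, §2 (2.25)–(2.42)] [cite: DobrushinShlosman1987]
[cite: Creutz2022] [cite: BauerschmidtBodineauDagallier2024] -/
theorem stub_twoScaleYM :
    ∃ (c : ℕ) (K₁ K₂ κ : ℝ), 0 < c ∧ 0 < κ ∧ ∀ ε : ℝ, 0 < ε → ∃ Cℓ : ℝ, 0 < Cℓ ∧ ∀ Λ' : ℝ, 0 < Λ' →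
      ∀ ℓ₁ : ℝ, Cℓ / Λ' ≤ ℓ₁ → ∀ (a : ℕ → ℝ), (∀ k, 0 < a k) → Tendsto a atTop (𝓝 0) →
      ∀ β' : ℕ → ℝ, Tendsto (fun k => β' k - afBeta 0 Λ' (a k)) atTop (𝓝 0) →
      ∀ᶠ k in atTop, ∀ (S'' N : ℕ) [NeZero N],
        ⌊ℓ₁ / a k⌋₊ * (2 * S'' + 1) ≤ N → N < ⌊ℓ₁ / a k⌋₊ * (2 * S'' + 3) →
        ∃ (βe : ℝ) (D O : QuasiLocalGaugePerturbation 4 (2 * S'' + 1) (Matrix.specialUnitaryGroup (Fin 3) ℂ) c),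
          |βe| ≤ ε ∧
          (∀ X : Finset (Site 4 (2 * S'' + 1)), X.card ≠ 1 →
            ∀ V : GaugeConfig 4 (2 * S'' + 1) (Matrix.specialUnitaryGroup (Fin 3) ℂ), D.act X V = 0) ∧
          (∀ (X : Finset (Site 4 (2 * S'' + 1)))
            (V : GaugeConfig 4 (2 * S'' + 1) (Matrix.specialUnitaryGroup (Fin 3) ℂ)), |D.act X V| ≤ K₁) ∧
          D.NormLE κ K₂ ∧ O.NormLE κ ε ∧
          (∀ X : Finset (Site 4 (2 * S'' + 1)), X ∈ polymers c →
            (∃ U : GaugeConfig 4 (2 * S'' + 1) (Matrix.specialUnitaryGroup (Fin 3) ℂ), O.act X U ≠ 0) →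
            ∀ y ∈ X, ∀ y' ∈ X, ∀ i : Fin 4, (y i - y' i).val ≤ c * X.card ∨ (y' i - y i).val ≤ c * X.card) ∧
          (wilsonMeasure (d := 4) (L := N) (fundamentalRep (Fin 3)) (β' k)).map
              (unevenAxialLink ⌊ℓ₁ / a k⌋₊ N (2 * S'' + 1)) =
            (D + O).perturbedMeasure (fundamentalRep (Fin 3)) βe := by
  sorry

/-- **stub_heavyQuarkBlockRemainder — FERMIONIC RE-ENTRY I: above the threshold the blocked SIGNED lattice-QCD
weight is a constant multiple of `e^{−W'} ×` the blocked Wilson weight at a MATCHED a.f. coupling, `W'` KP-small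
with range control (cards proper-time-residual-determinant + rao-blackwell-sign folded in; triage 3 (i)–(ii)
honoured: sizes from the BLOCK operator, positivity demanded for `N_f = 2` AND `3`).** For `N_f ∈ {2, 3}` and every
X₀-HONEST regularisation `reg` (hypothesis = the `∃ reg`-body of `ContinuumQCDExists` INCLUDING the three
non-triviality clauses — Disproof §2 honoured here) there is `Λs > 0` (a lower bound for the matched pure-gauge scale
parameters above mass `1`) such that for all `ℓ₁ > 0`, `κ > 0`, `c ≥ 1`, `ε' > 0` there is a threshold `M₅` with:
for every mass tuple `m > M₅` there are a MATCHED coupling sequence `β'` and `Λ' ≥ Λs` with `N_f = 0` asymptotic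
scaling (`β'_k − afBeta 0 Λ' a_k → 0`: the one-loop heavy-threshold log + two-loop log-log of `CouplingMatching`,
stmt-8797 — Disproof §9(i): the DIVERGENT marginal shift lives in `β' − β`, never in `W'`) such that eventually in
`k`, for every block torus `2S''+1` and fine torus `N` in the window, there are a block-scale quasi-local `W'` at cube
scale `c` with `‖W'‖_{c,κ} ≤ ε'` and range control, and a REAL CONSTANT `Z ≠ 0`, with, for every measurable set `E`
of block fields: `∫_{Φ⁻¹E} (∫dψ̄dψ e^{−ψ̄ D(U) ψ}) dμ_{N,β_k}(U) = Z · ∫_{Φ⁻¹E} e^{−W'(Φ U)} dμ_{N,β'_k}(U)`,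
`Φ = unevenAxialLink b_k N (2S''+1)`, `D(U)` the `N_f`-flavour Wilson–Dirac operator at the scheme's OWN bare masses
`m_crit(k) + a_k m_f/Z_m(k)` (tree `fermiIntegral ∘ fermiBoltzmann`, exactly the signed unquenched weight of
`qcdTorusExpect`). CONTENT: (a) POSITIVITY of the fibre-averaged signed weight (`Z ≠ 0` real and a positive
integrand on the right force a constant sign of the blocked complex measure — rao-blackwell-sign in its a.e. form,
load-bearing for BOTH conjuncts since `QCDOf 2` ranges over split masses (barriers `WilsonDeterminantSign`,
`WilsonDeterminantMassSplitting` are configuration-wise and do not speak about fibre averages); `Z` may be negative: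
the Berezin orientation sign depends on the number of quark variables); (b) QuarkRemainderSmall in SUP KP norm over
ALL block fields, rough ones included: relative to blocked Yang–Mills at the matched coupling, `−log` of the ratio
of blocked densities is a sum of cube-local terms of size `O(N_f (ℓ₁ M₀)^{−2})` after β-matching (dimension-6
irrelevant operators, Symanzik/Appelquist–Carazzone — triage 1/3: POWER-small, not `e^{−(ℓ₁M₀)²}`) plus inter-cube
terms `O(e^{−c M₀ ℓ₁·distance})`, hence `≤ ε'` above a threshold `M₅(ℓ₁, κ, c, ε', reg)`; (c) HONEST SCOPE — this
stub CONTAINS, besides the a.f.-scale block integration of heavy Wilson quarks (engine-grade: coercive BLOCK Dirac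
operator at scale `c_q/M₀`, convergent covariant hopping/polymer expansion conditional on the block field; never the
fine operator, Disproof §9(ii)/§10), the CROSSOVER TRANSPORT of the resulting small perturbation from `c_q/M₀` to the
hadronic scale `ℓ₁` in sup-KP norm (FINDINGS B4, triage 2): a comparison of blocked QCD and blocked matched-YM
densities at a hadronic scale, pointwise in the block field — a stability statement through the crossover that
`stub_twoScaleYM` (which is `W`-free) does NOT supply. Reshape option for the lead: split into S5q (engine-side
handover at `c_q/M₀` in D1′ format, `HasBlockScaleEffectivePerturbation`) and S5t (YM-side Lipschitz transport
`c_q/M₀ → ℓ₁` of small D1′ perturbations into the sup-KP class), at the price of a seventh stub and of postulating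
transport-level robustness. Why it might fail: the crossover transport (c); exceptional block fields where the block
Dirac operator loses coercivity (low-mode-quarantine / band-limited-payload are the recorded repair formats); a
positive-measure set of block fields with negative fibre average at `N_f = 3` (the card's 2D two-flavour toy is the
cheap test, not run). Degenerate checks: `b_k = 0` empties the window; `z = shift = 0` in the bare masses is no loss
(`hasLatticeMassGap_scheme_indep`); honesty excludes `canonicalAF`. Size: XL (L without (c)). Leans on: tree
`fermiIntegral`, `fermiBoltzmann`, `QCDRegularisation.scheme`, `wilsonMeasure`, `afBeta`,
`QuasiLocalGaugePerturbation.{NormLE, act, total}`, `polymers`, items `CouplingMatching` 8797 (provable-now),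
`WilsonFermionBlockAveraging` (D2), `BlockScaleEffectivePerturbation` (D1′), `QCDHeavyQuarkPropagator`; §0
`unevenAxialLink`. [cite: AppelquistCarazzone1975] [cite: BrunoEtAl2015HeavySea] [cite: Balaban1988Convergent]
[cite: BalabanOcarrollSchor1989] [cite: MontvayMunster1994, §5.1] [cite: Luscher1977] -/
theorem stub_heavyQuarkBlockRemainder :
    ∀ Nf : ℕ, Nf = 2 ∨ Nf = 3 → ∀ reg : QCDRegularisation Nf,
      (reg.HasMassScaling ∧ ∀ m : Fin Nf → ℝ, (∀ f, 0 < m f) →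
        ∃ (z shift : QCDField Nf → ℕ → ℝ) (T : OSData (QCDField Nf) 4),
          IsQCDAlong (reg.scheme m z shift) T ∧ T.IsNontrivial QCDField.glue ∧ T.IsNonGaussian QCDField.glue ∧
            ∀ f g : Fin Nf, f ≠ g → T.IsNontrivial (QCDField.pseudoRe f g)) →
      ∃ Λs : ℝ, 0 < Λs ∧ ∀ (ℓ₁ κ : ℝ) (c : ℕ) (ε' : ℝ), 0 < ℓ₁ → 0 < κ → 0 < c → 0 < ε' →
        ∃ M₅ : ℝ, ∀ m : Fin Nf → ℝ, (∀ f, M₅ < m f) →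
          ∃ (β' : ℕ → ℝ) (Λ' : ℝ), Λs ≤ Λ' ∧
            Tendsto (fun k => β' k - afBeta 0 Λ' (reg.a k)) atTop (𝓝 0) ∧
            ∀ᶠ k in atTop, ∀ (S'' N : ℕ) [NeZero N],
              ⌊ℓ₁ / reg.a k⌋₊ * (2 * S'' + 1) ≤ N → N < ⌊ℓ₁ / reg.a k⌋₊ * (2 * S'' + 3) →
              ∃ (W' : QuasiLocalGaugePerturbation 4 (2 * S'' + 1) (Matrix.specialUnitaryGroup (Fin 3) ℂ) c)
                (Z : ℝ), W'.NormLE κ ε' ∧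
                (∀ X : Finset (Site 4 (2 * S'' + 1)), X ∈ polymers c →
                  (∃ U : GaugeConfig 4 (2 * S'' + 1) (Matrix.specialUnitaryGroup (Fin 3) ℂ), W'.act X U ≠ 0) →
                  ∀ y ∈ X, ∀ y' ∈ X, ∀ i : Fin 4,
                    (y i - y' i).val ≤ c * X.card ∨ (y' i - y i).val ≤ c * X.card) ∧
                Z ≠ 0 ∧
                ∀ E : Set (GaugeConfig 4 (2 * S'' + 1) (Matrix.specialUnitaryGroup (Fin 3) ℂ)), MeasurableSet E →
                  ∫ U in (unevenAxialLink ⌊ℓ₁ / reg.a k⌋₊ N (2 * S'' + 1)) ⁻¹' E,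
                      fermiIntegral (fermiBoltzmann U fun f => (reg.scheme m 0 0).mq f k)
                    ∂(wilsonMeasure (d := 4) (L := N) (fundamentalRep (Fin 3)) (reg.β k)) =
                  (Z : ℂ) * ((∫ U in (unevenAxialLink ⌊ℓ₁ / reg.a k⌋₊ N (2 * S'' + 1)) ⁻¹' E,
                      Real.exp (-(W'.total (unevenAxialLink ⌊ℓ₁ / reg.a k⌋₊ N (2 * S'' + 1) U)))
                    ∂(wilsonMeasure (d := 4) (L := N) (fundamentalRep (Fin 3)) (β' k)) : ℝ) : ℂ) := by
  sorry

/-- **stub_fineFromBlock — FERMIONIC RE-ENTRY II + TRANSFER: block representation + UNIFORM block clustering ⇒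
the full-spectrum lattice gap clause for ALL fine lattice-QCD observables, above the threshold.** For
`N_f ∈ {2, 3}`, every HONEST `reg` (Disproof §2 honoured again: the threshold is physical only for honest
calibrations), every block scale `ℓ₁ > 0`, cube size `c ≥ 1` and block rate `mr > 0` there is a threshold `M₆`
with: for every mass tuple `m > M₆` and every coupling sequence `β'`, IF there is a constant map
`C : (A, B) ↦ C_{AB}` such that eventually in `k`, for every block torus `2S''+1` and fine torus `N` in the window,
some `(βₑ, D, O, W', Z ≠ 0)` satisfy (i) the blocked Wilson measure at `β'_k` is `(D + O).perturbedMeasure ρ βₑ`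
(stub 2's shape), (ii) the blocked signed QCD weight of `reg.scheme m 0 0` at step `k` is `Z · e^{−W'} ×` the
Wilson weight at `β'_k` (stub 5's shape) — so that the normalised blocked QCD measure IS
`(D + O + W').perturbedMeasure ρ βₑ` and block observables `B ∘ Φ` have QCD expectations equal to its expectations —
and (iii) ALL bounded gauge-invariant block-cylinder observables cluster under it at rate `mr` per block-time unit
with prefactors `C_{AB}` (stub 4's shape), THEN `(reg.scheme m 0 0).HasLatticeMassGap (mr/(4ℓ₁))`: every pair of
gauge-invariant local lattice-QCD observables (Wilson loops, mesons, baryons, quark boxes `R, R'`) has connected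
Euclidean-time correlations `≤ C e^{−(mr/(4ℓ₁)) a_k n}` on every torus `2S+1 ≥ 2L_k+1`, `n ≤ S`, eventually in `k`
(rate bookkeeping: cube sides `< 3 b_k` and `b_k a_k ≤ ℓ₁` give `≥ mr a_k/(3ℓ₁)` per fine time unit, the remaining
slack is for the transfer; tori `2S+1 ≥ 2L_k+1 ≥ b_k` are covered by the windows eventually since `a_k L_k → ∞`).
CONTENT — two mechanisms, both at FIXED cutoff (no Yang–Mills-strength input is hidden here):
(G) GLUONIC / flavour-neutral channels: block observables `B ∘ Φ` are special fine observables; at fixed `k` (all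
volumes), Lüscher–Osterwalder–Seiler positivity gives the transfer matrix `𝕋_k` (its range `κ_f(k) < 1/6` holds
eventually for every honest `reg`: sorry-free `fineHopping_lt_sixth_of_honest` in §2, from the landed
`Negative.HoppingWindow`, Disproof §12(A)); uniform block clustering for ALL
block cylinder observables at ALL block times puts the spectral measures of the vectors `M_{B₁}𝕋^{b}M_{B₂}⋯Ω` off
`(0, Δ)`; the fixed-cutoff CYCLICITY LEMMA — these vectors are dense in the charge-zero sector (the dynamics `𝕋^b`
separates the `b³` Brillouin sub-zone components of a fine excitation by their distinct energies; checked on the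
free field, where block form factors vanish only on null sets and Vandermonde in `e^{−ω(p + 2πj/b) b n}` does the
rest) — then gives `P_{(0,Δ)} = 0` on that sector and fine clustering with constants `‖A‖∞‖B‖∞`, UNIFORM in `k`;
the finite symmetric torus (twisted trace, `n ≤ S`) is handled as in `GapTransfer`'s gaps G1–G2 (thermal
corrections `O(volume · e^{−Δ a (2S+1)})`). ALTERNATIVE for (G), recorded not chosen: V-uniform decorrelation of the
fine field given the block field (FibreMixing) — triage 2 showed it is hadronic-scale YM-strength content and it is
NOT robust under the quark weight, so it is deliberately NOT a hypothesis here; a prover who needs it must ask the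
lead for a reshape adding `FibreMixing(ℓ₁)` to stub 2 (weakening the line). (Q) FLAVOURED / baryonic channels and
quark-carrying observables: heavy QUARK LINES at the block scale — the Berezin integral of `A · e^{−ψ̄Dψ}` is
`det D ×` contractions with propagators; above the threshold lines of physical length `ℓ` weigh `≤ e^{−c M₀ ℓ}`
after blocking (coercive block operator, `HeavyBlockIntegration`-type; NOT the fine operator, whose bare mass is
eventually negative — Disproof §9(ii)), so charged sectors are gapped at rate `≍ M₀ ≫ mr/(4ℓ₁)` once
`M₆ = M₆(ℓ₁, mr, reg)` is large. Why it might fail: (G) the cyclicity lemma is new (plausible, unproved; its failure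
mode would be a conserved fibre structure commuting with `𝕋^b`, which Wilson's action does not have); the
finite-torus thermal bookkeeping with volume-uniform constants; (Q) block-scale coercivity on exceptional block
fields (low-mode-quarantine's budget `ActionBoundsLowModes` 8872 is the recorded repair). Degenerate checks: the
witnesses `(βₑ, D, O, W', Z)` may depend on `(k, S'', N)` but the MEASURE they define is pinned by (i)–(ii), so (iii)
is witness-independent; without the threshold/honesty the statement would be FALSE (light pions in flavoured
channels are invisible to gluonic block observables) — hence `∃ M₆` after an honest `reg`. Size: XL. Leans on: tree
`QCDScheme.HasLatticeMassGap`, `qcdLatticeConnectedCorr`, `qcdTorusExpect`, `QCDLatticeObservable`, `fermiIntegral`,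
`fermiBoltzmann`, `wilsonMeasure`, `QuasiLocalGaugePerturbation.{perturbedMeasure, connectedCorr}`, `YMSpecies`,
`QCDTransferMatrix`/`QCDSlab` files (Lüscher positivity), §0 `unevenAxialLink`.
[cite: Luscher1977] [cite: OsterwalderSeiler1978, §§2–4] [cite: Seiler1982, Ch. 3]
[cite: MontvayMunster1994, §5.1] [cite: DobrushinShlosman1987] -/
theorem stub_fineFromBlock :
    ∀ Nf : ℕ, Nf = 2 ∨ Nf = 3 → ∀ reg : QCDRegularisation Nf,
      (reg.HasMassScaling ∧ ∀ m : Fin Nf → ℝ, (∀ f, 0 < m f) →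
        ∃ (z shift : QCDField Nf → ℕ → ℝ) (T : OSData (QCDField Nf) 4),
          IsQCDAlong (reg.scheme m z shift) T ∧ T.IsNontrivial QCDField.glue ∧ T.IsNonGaussian QCDField.glue ∧
            ∀ f g : Fin Nf, f ≠ g → T.IsNontrivial (QCDField.pseudoRe f g)) →
      ∀ (ℓ₁ : ℝ) (c : ℕ) (mr : ℝ), 0 < ℓ₁ → 0 < c → 0 < mr →
        ∃ M₆ : ℝ, ∀ m : Fin Nf → ℝ, (∀ f, M₆ < m f) → ∀ β' : ℕ → ℝ,
          (∃ C : YMSpecies (Matrix.specialUnitaryGroup (Fin 3) ℂ) →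
              YMSpecies (Matrix.specialUnitaryGroup (Fin 3) ℂ) → ℝ,
            ∀ᶠ k in atTop, ∀ (S'' N : ℕ) [NeZero N],
              ⌊ℓ₁ / reg.a k⌋₊ * (2 * S'' + 1) ≤ N → N < ⌊ℓ₁ / reg.a k⌋₊ * (2 * S'' + 3) →
              ∃ (βe : ℝ) (D O W' : QuasiLocalGaugePerturbation 4 (2 * S'' + 1)
                  (Matrix.specialUnitaryGroup (Fin 3) ℂ) c) (Z : ℝ),
                Z ≠ 0 ∧
                (wilsonMeasure (d := 4) (L := N) (fundamentalRep (Fin 3)) (β' k)).map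
                    (unevenAxialLink ⌊ℓ₁ / reg.a k⌋₊ N (2 * S'' + 1)) =
                  (D + O).perturbedMeasure (fundamentalRep (Fin 3)) βe ∧
                (∀ E : Set (GaugeConfig 4 (2 * S'' + 1) (Matrix.specialUnitaryGroup (Fin 3) ℂ)), MeasurableSet E →
                  ∫ U in (unevenAxialLink ⌊ℓ₁ / reg.a k⌋₊ N (2 * S'' + 1)) ⁻¹' E,
                      fermiIntegral (fermiBoltzmann U fun f => (reg.scheme m 0 0).mq f k)
                    ∂(wilsonMeasure (d := 4) (L := N) (fundamentalRep (Fin 3)) (reg.β k)) =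
                  (Z : ℂ) * ((∫ U in (unevenAxialLink ⌊ℓ₁ / reg.a k⌋₊ N (2 * S'' + 1)) ⁻¹' E,
                      Real.exp (-(W'.total (unevenAxialLink ⌊ℓ₁ / reg.a k⌋₊ N (2 * S'' + 1) U)))
                    ∂(wilsonMeasure (d := 4) (L := N) (fundamentalRep (Fin 3)) (β' k)) : ℝ) : ℂ)) ∧
                ∀ (A B : YMSpecies (Matrix.specialUnitaryGroup (Fin 3) ℂ)) (n : ℕ), n ≤ S'' →
                  |(D + O + W').connectedCorr (fundamentalRep (Fin 3)) βe A.F B.F n| ≤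
                    C A B * Real.exp (-(mr * n))) →
          (reg.scheme m 0 0).HasLatticeMassGap (mr / (4 * ℓ₁)) := by
  sorry

/-! ## §2 Sorry-free glue: Lüscher's range along honest trajectories, range control of sums, and the five
mechanism stubs ⇒ `MassiveLatticeGap` (8922) -/

/-- **Disproof §12(A), USED — the fixed-cutoff transfer matrix of `stub_fineFromBlock` (G) lives in Lüscher's
positivity range.** For an X₀-honest `reg` (the hypothesis of stubs 5–6), every mass tuple `m > 0` and every
flavour `f`, the FINE Wilson hopping parameter `κ_f(k) = 1/(2 m_f(k) + 8)` of the scheme `reg.scheme m 0 0` (the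
scheme stubs 5–6 speak about; its bare masses do not read `z, shift`) is eventually `< 1/6`, i.e. `m_f(k) > −1`
(physical-branch clause of `IsQCDAlong`), the range in which the Wilson-fermion transfer matrix is positive
(Lüscher 1977; Montvay–Münster (4.111)) — via the LANDED `Negative.hoppingParam_lt_sixth_iff` (HoppingWindow.lean).
The complementary lower edge `κ_f(k) > 1/8` (`Negative.scheme_hoppingParam_window`, one-loop-deep `m_crit`) is the
reason no stub expands the fine operator in the hopping parameter. [cite: Luscher1977]
[cite: MontvayMunster1994, §4.2.3 (4.111)] -/
theorem fineHopping_lt_sixth_of_honest {Nf : ℕ} (reg : QCDRegularisation Nf)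
    (hreg : reg.HasMassScaling ∧ ∀ m : Fin Nf → ℝ, (∀ f, 0 < m f) →
      ∃ (z shift : QCDField Nf → ℕ → ℝ) (T : OSData (QCDField Nf) 4),
        IsQCDAlong (reg.scheme m z shift) T ∧ T.IsNontrivial QCDField.glue ∧ T.IsNonGaussian QCDField.glue ∧
          ∀ f g : Fin Nf, f ≠ g → T.IsNontrivial (QCDField.pseudoRe f g))
    (m : Fin Nf → ℝ) (hm : ∀ f, 0 < m f) (f : Fin Nf) :
    ∀ᶠ k in atTop, 1 / (2 * (reg.scheme m 0 0).mq f k + 8) < (1 : ℝ) / 6 := by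
  obtain ⟨z, shift, T, hA, -, -, -⟩ := hreg.2 m hm
  have hbranch : ∀ᶠ k in atTop, -1 < (reg.scheme m z shift).mq f k := hA.2.1 f
  filter_upwards [hbranch] with k hk
  have hmq : (reg.scheme m 0 0).mq f k = (reg.scheme m z shift).mq f k := rfl
  rw [hmq]
  have h8 : 0 < 2 * (reg.scheme m z shift).mq f k + 8 := by linarith
  exact (Summit.QuantumFields.QCD.Theorems.RobustYangMillsHandover.Negative.hoppingParam_lt_sixth_iff h8).2 hk

/-- **Range control is stable under the sums the composition forms**: a cube-diagonal `D` (activities only on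
single cubes: diameter `0`) plus two range-controlled perturbations is range-controlled — an activity-carrying
polymer of the sum carries an activity of one summand. [folklore] -/
theorem rangeControl_add3 {S c : ℕ} {G : Type*} [Group G] [MeasurableSpace G]
    (D O W : QuasiLocalGaugePerturbation 4 (2 * S + 1) G c)
    (hD : ∀ X : Finset (Site 4 (2 * S + 1)), X.card ≠ 1 → ∀ V : GaugeConfig 4 (2 * S + 1) G, D.act X V = 0)
    (hO : ∀ X : Finset (Site 4 (2 * S + 1)), X ∈ polymers c →
      (∃ U : GaugeConfig 4 (2 * S + 1) G, O.act X U ≠ 0) →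
      ∀ y ∈ X, ∀ y' ∈ X, ∀ i : Fin 4, (y i - y' i).val ≤ c * X.card ∨ (y' i - y i).val ≤ c * X.card)
    (hW : ∀ X : Finset (Site 4 (2 * S + 1)), X ∈ polymers c →
      (∃ U : GaugeConfig 4 (2 * S + 1) G, W.act X U ≠ 0) →
      ∀ y ∈ X, ∀ y' ∈ X, ∀ i : Fin 4, (y i - y' i).val ≤ c * X.card ∨ (y' i - y i).val ≤ c * X.card) :
    ∀ X : Finset (Site 4 (2 * S + 1)), X ∈ polymers c →
      (∃ U : GaugeConfig 4 (2 * S + 1) G, (D + O + W).act X U ≠ 0) →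
      ∀ y ∈ X, ∀ y' ∈ X, ∀ i : Fin 4, (y i - y' i).val ≤ c * X.card ∨ (y' i - y i).val ≤ c * X.card := by
  intro X hX hU y hy y' hy' i
  obtain ⟨U, hU⟩ := hU
  simp only [QuasiLocalGaugePerturbation.add_act] at hU
  by_cases hD0 : D.act X U = 0
  · by_cases hO0 : O.act X U = 0
    · have hW0 : W.act X U ≠ 0 := by
        intro h
        apply hU
        rw [hD0, hO0, h]
        simp
      exact hW X hX ⟨U, hW0⟩ y hy y' hy' i
    · exact hO X hX ⟨U, hO0⟩ y hy y' hy' i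
  · have hcard : X.card = 1 := by
      by_contra h
      exact hD0 (hD X h U)
    obtain ⟨z, rfl⟩ := Finset.card_eq_one.mp hcard
    simp only [Finset.mem_singleton] at hy hy'
    subst hy
    subst hy'
    left
    simp

/-- **The five mechanism stubs prove the lattice half = item `GradientFlowSpecies.MassiveLatticeGap` (8922) on the
nose** (a proof of stubs 2–6 in `Theorems/` is, with this glue, a proof of item 8922 and conversely the glue shows
how the line's currencies compose). Order of constants — the whole point of the line is that it closes WITHOUT
circularity: Yang–Mills fixes `(c, K₁, K₂, κ)` (stub 2); the criterion turns them into the smallness `εs` and the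
Poincaré constant `CP` (stub 3); Yang–Mills is asked for target smallness `εs/2`, giving `Cℓ` (stub 2); honesty of
`reg` gives `Λs` (stub 5), whence the PHYSICAL handover scale `ℓ₁ := Cℓ/Λs`; the clustering rate `mr` depends only on
`(c, κ, K₂ + εs, CP, εs)` (stub 4); the thresholds `M₅ = M₅(ℓ₁, κ, c, εs/2)` (stub 5: quark remainder `≤ εs/2`) and
`M₆ = M₆(ℓ₁, c, mr)` (stub 6) give `M := max M₅ M₆`; for `m > M` stub 5 supplies the matched `β'`, `Λ' ≥ Λs` (so
`ℓ₁ ≥ Cℓ/Λ'` and stub 2 applies to `β'`), and eventually in `k`, on every block torus, the data `(βₑ, D, O)` and the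
remainder `(W', Z)`; ROBUSTNESS IS THE TRIANGLE INEQUALITY `‖O + W'‖_{c,κ} ≤ εs/2 + εs/2` (`NormLE.add`) feeding
stub 3 at `(D, O + W')`, then `(D + O) + W' = D + (O + W')` (`ext` + `add_assoc`), `‖D + O + W'‖ ≤ K₂ + εs`,
`rangeControl_add3`, and stub 4 give the uniform block clustering that stub 6 converts into
`HasLatticeMassGap (mr/(4ℓ₁))`. [folklore] -/
theorem massiveLatticeGap_of_stubs :
    Summit.QuantumFields.QCD.Theses.GradientFlowSpecies.MassiveLatticeGap := by
  intro Nf hNf reg hreg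
  obtain ⟨c, K₁, K₂, κ, hc, hκ, hYM⟩ := stub_twoScaleYM
  obtain ⟨εs, hεs, CP, hcrit⟩ :=
    stub_twoScaleCriterion (Matrix.specialUnitaryGroup (Fin 3) ℂ) su3Rep c K₁ K₂ κ hc hκ
  obtain ⟨Cℓ, hCℓ, hdata⟩ := hYM (εs / 2) (half_pos hεs)
  obtain ⟨Λs, hΛs, hquark⟩ := stub_heavyQuarkBlockRemainder Nf hNf reg hreg
  obtain ⟨mr, hmr, hclus⟩ :=
    stub_perturbedPoincareToClustering (Matrix.specialUnitaryGroup (Fin 3) ℂ) su3Rep c κ (K₂ + εs) CP εs hc hκ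
  choose Cf hCf using hclus
  have hℓ₁ : 0 < Cℓ / Λs := div_pos hCℓ hΛs
  obtain ⟨M₅, hM₅⟩ := hquark (Cℓ / Λs) κ c (εs / 2) hℓ₁ hκ hc (half_pos hεs)
  obtain ⟨M₆, hM₆⟩ := stub_fineFromBlock Nf hNf reg hreg (Cℓ / Λs) c mr hℓ₁ hc hmr
  refine ⟨max M₅ M₆, fun m hm => ⟨mr / (4 * (Cℓ / Λs)), by positivity, ?_⟩⟩
  have hm5 : ∀ f, M₅ < m f := fun f => lt_of_le_of_lt (le_max_left _ _) (hm f)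
  have hm6 : ∀ f, M₆ < m f := fun f => lt_of_le_of_lt (le_max_right _ _) (hm f)
  obtain ⟨β', Λ', hΛ', haf, hq⟩ := hM₅ m hm5
  have hΛ'pos : 0 < Λ' := lt_of_lt_of_le hΛs hΛ'
  have hℓ₁' : Cℓ / Λ' ≤ Cℓ / Λs := div_le_div_of_nonneg_left hCℓ.le hΛs hΛ'
  have hym := hdata Λ' hΛ'pos (Cℓ / Λs) hℓ₁' reg.a reg.a_pos reg.tendsto_a β' haf
  refine hM₆ m hm6 β' ⟨Cf, ?_⟩
  filter_upwards [hym, hq] with k hk hk' S'' N _ h1 h2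
  obtain ⟨βe, D, O, hβe, hDd, hDK₁, hDK₂, hOε, hOrc, hrep⟩ := hk S'' N h1 h2
  obtain ⟨W', Z, hW'ε, hW'rc, hZ, hid⟩ := hk' S'' N h1 h2
  refine ⟨βe, D, O, W', Z, hZ, hrep, hid, fun A B n hn => ?_⟩
  have hβe' : |βe| ≤ εs := hβe.trans (by linarith)
  -- robustness = Holley–Stroock (inside stub 3) + THIS triangle inequality for the KP norm:
  have hOW : (O + W').NormLE κ εs := (hOε.add hW'ε).mono (by linarith)
  have hP := hcrit βe hβe' S'' D (O + W') hDd hDK₁ hDK₂ hOW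
  have hassoc : D + O + W' = D + (O + W') :=
    QuasiLocalGaugePerturbation.ext (by funext X U; simp [add_assoc])
  have htot : (D + O + W').NormLE κ (K₂ + εs) := ((hDK₂.add hOε).add hW'ε).mono (by linarith)
  have hrc := rangeControl_add3 D O W' hDd hOrc hW'rc
  rw [← hassoc] at hP
  exact hCf A B βe hβe' S'' (D + O + W') htot hrc hP n hn

/-! ## §3 The common head (re-derived here over the LANDED gap-clause lemmas) and the skeleton theorem -/

/-- **The common head of every line on this crux** (hypotheses BY NAME = items 8923 and 8922; identical to the head
line's `handover_of_gapTransfer_of_massiveLatticeGap`, but using the LANDED `Negative.GapClauses` lemmas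
`hasLatticeMassGap_scheme_indep` / `hasLatticeMassGap_anti` instead of restated copies):
`GapTransfer → MassiveLatticeGap → (ContinuumQCDExists → QCD)`, via the landed `qcdOf_iff_threshold` with
`M₀ := max M 0` for X₀'s OWN regularisation and data. [folklore] -/
theorem handover_of_gapTransfer_of_massiveLatticeGap
    (hGT : Summit.QuantumFields.QCD.Theses.GradientFlowSpecies.GapTransfer)
    (hML : Summit.QuantumFields.QCD.Theses.GradientFlowSpecies.MassiveLatticeGap) :
    ContinuumQCDExists → _root_.QCD := by
  intro hX
  have key : ∀ Nf : ℕ, (Nf = 2 ∨ Nf = 3) → QCDOf Nf := by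
    intro Nf hNf
    obtain ⟨reg, hms, hb⟩ := hX Nf hNf
    obtain ⟨M, hM⟩ := hML Nf hNf reg ⟨hms, hb⟩
    refine (qcdOf_iff_threshold Nf).mpr ⟨max M 0, le_max_right _ _, reg, hms, fun m hm => ?_⟩
    have hm0 : ∀ f, 0 < m f := fun f => lt_of_le_of_lt (le_max_right M 0) (hm f)
    have hmM : ∀ f, M < m f := fun f => lt_of_le_of_lt (le_max_left M 0) (hm f)
    obtain ⟨z, shift, T, hA, hN, hG, hP⟩ := hb m hm0
    obtain ⟨Δ, hΔ, hL⟩ := hM m hmM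
    have hL' : (reg.scheme m z shift).HasLatticeMassGap Δ :=
      (Summit.QuantumFields.QCD.Theorems.RobustYangMillsHandover.Negative.hasLatticeMassGap_scheme_indep
        reg m 0 0 z shift Δ).mp hL
    refine ⟨z, shift, T, hA, hN, hG, hP, Δ / 2, half_pos hΔ, ?_, ?_⟩
    · exact hGT Nf (reg.scheme m z shift) T Δ (Δ / 2) (half_pos hΔ) (half_lt_self hΔ) hA hL'
    · exact Summit.QuantumFields.QCD.Theorems.RobustYangMillsHandover.Negative.hasLatticeMassGap_anti _
        (half_le_self hΔ.le) hL'
  exact ⟨key 2 (Or.inl rfl), key 3 (Or.inr rfl)⟩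

/-- **RobustYangMillsHandover_of — the line closes the crux modulo exactly the six registered stubs**
(conclusion = the route decl BY NAME; `stub_gapTransfer` pays the continuum half, stubs 2–6 the lattice half through
`massiveLatticeGap_of_stubs`). -/
theorem RobustYangMillsHandover_of :
    Summit.QuantumFields.QCD.Theses.HeatSlicedQuarks.RobustYangMillsHandover :=
  handover_of_gapTransfer_of_massiveLatticeGap stub_gapTransfer massiveLatticeGap_of_stubs

/-- Sanity link: the crux IS the arrow the head concludes. [folklore] -/
theorem robustYangMillsHandover_iff :
    Summit.QuantumFields.QCD.Theses.HeatSlicedQuarks.RobustYangMillsHandover ↔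
      (ContinuumQCDExists → _root_.QCD) :=
  Iff.rfl

end Summit.QuantumFields.QCD.Cruxes.RobustYangMillsHandover.TwoScaleLsiHandover

end
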